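import Summits.QuantumFields.YangMills.Theorems.ColdStartUniversalityLatticeLangevinDossSussmannSmoothingPrep2
import HarnessLib

/-!
# Route `ColdStartUniversality` (fixed-cut-off SZZ dynamics; Doss–Sussmann smoothing programme, file 12):
# DIFFERENTIATING UNDER THE EXPECTATION TO ANY ORDER

Helper file (seat `ym-line-csu-p1`, g24).  The abstract `C¹` step of file 8 (`contDiffOn_one_integral`) iterated:
★ `contDiffOn_integral_of_iteratedFDerivWithin_le` — if every sample `F(·, ω)` is `Cⁿ` on an open set `U₀` of a
finite-dimensional space, `F(M, ·)` is measurable for `M ∈ U₀`, and all derivatives of order `≤ n` are LOCALLY UNIFORMLY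
(in `ω`) bounded, then `M ↦ ∫ F(M, ω) dμ(ω)` is `Cⁿ` on `U₀` (finite measure).  Induction on `n`, the codomain changing
from `E'` to `H →L E'` at each step (derivatives measured through `iteratedFDerivWithin`, shifted by
`norm_iteratedFDerivWithin_fderivWithin`).
THEOREMS ONLY, no sorry.  HONEST FRAMING: plumbing; nothing K-uniform; no crux, rung or summit statement is proved; the
Yang–Mills mass gap is NOT proved.
-/

set_option autoImplicit false

noncomputable section

namespace Summit.QuantumFields.YangMills.Theorems.ColdStartUniversality

open MeasureTheory Finset Filter Set Metric Function
open scoped NNReal Topology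

universe u v

/-- On an open set, `‖fderiv f x‖ = ‖iteratedFDerivWithin 1 f U₀ x‖`. [folklore] -/
theorem norm_fderiv_eq_norm_iteratedFDerivWithin_one {H : Type*} [NormedAddCommGroup H] [NormedSpace ℝ H]
    {E' : Type*} [NormedAddCommGroup E'] [NormedSpace ℝ E'] {U₀ : Set H} (hU₀ : IsOpen U₀) {f : H → E'}
    {x : H} (hx : x ∈ U₀) : ‖fderiv ℝ f x‖ = ‖iteratedFDerivWithin ℝ 1 f U₀ x‖ := by
  rw [← fderivWithin_of_isOpen hU₀ hx, ← norm_iteratedFDerivWithin_fderivWithin hU₀.uniqueDiffOn hx,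
    norm_iteratedFDerivWithin_zero]

/-- On an open set, the iterated derivatives of `fderiv f` within `U₀` are those of `f`, shifted. [folklore] -/
theorem norm_iteratedFDerivWithin_fderiv_of_isOpen {H : Type*} [NormedAddCommGroup H] [NormedSpace ℝ H]
    {E' : Type*} [NormedAddCommGroup E'] [NormedSpace ℝ E'] {U₀ : Set H} (hU₀ : IsOpen U₀) {f : H → E'}
    {x : H} (hx : x ∈ U₀) (k : ℕ) :
    ‖iteratedFDerivWithin ℝ k (fderiv ℝ f) U₀ x‖ = ‖iteratedFDerivWithin ℝ (k + 1) f U₀ x‖ := by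
  have heq : Set.EqOn (fderiv ℝ f) (fderivWithin ℝ f U₀) U₀ := fun y hy => (fderivWithin_of_isOpen hU₀ hy).symm
  rw [iteratedFDerivWithin_congr heq hx, norm_iteratedFDerivWithin_fderivWithin hU₀.uniqueDiffOn hx]

/-- ★ **Differentiation under the integral sign to order `n`.**  Let `μ` be a finite measure, `H` finite-dimensional,
`U₀ ⊆ H` open, and `F : H → Ω → E'` with: `F(M, ·)` a.e.-strongly measurable for `M ∈ U₀`; every sample `F(·, ω)` of
class `Cⁿ` on `U₀`; and, locally near each point of `U₀`, a bound `C` with `‖D^k F(·, ω)(M)‖ ≤ C` for all `k ≤ n`, all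
`ω` and all `M` in a ball.  Then `M ↦ ∫ F(M, ω) dμ` is `Cⁿ` on `U₀`. [folklore] -/
theorem contDiffOn_integral_of_iteratedFDerivWithin_le {Ω : Type*} [MeasurableSpace Ω] {μ : Measure Ω}
    [IsFiniteMeasure μ] {H : Type u} [NormedAddCommGroup H] [NormedSpace ℝ H] [FiniteDimensional ℝ H]
    {U₀ : Set H} (hU₀ : IsOpen U₀) (n : ℕ) :
    ∀ {E' : Type u} [NormedAddCommGroup E'] [NormedSpace ℝ E'] [CompleteSpace E'] {F : H → Ω → E'},
      (∀ M ∈ U₀, AEStronglyMeasurable (F M) μ) →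
      (∀ ω, ContDiffOn ℝ n (fun M => F M ω) U₀) →
      (∀ M₀ ∈ U₀, ∃ ε > 0, ∃ C : ℝ, ball M₀ ε ⊆ U₀ ∧ ∀ ω, ∀ M ∈ ball M₀ ε, ∀ k ≤ n,
        ‖iteratedFDerivWithin ℝ k (fun M => F M ω) U₀ M‖ ≤ C) →
      ContDiffOn ℝ n (fun M => ∫ ω, F M ω ∂μ) U₀ := by
  induction n with
  | zero =>
    intro E' _ _ _ F hmeas hsm hbd
    rw [Nat.cast_zero, contDiffOn_zero]
    intro M₀ hM₀
    obtain ⟨ε, hε, C, hball, hC⟩ := hbd M₀ hM₀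
    have key : ContinuousAt (fun M => ∫ ω, F M ω ∂μ) M₀ := by
      refine continuousAt_of_dominated (bound := fun _ => C) ?_ ?_ (integrable_const C) ?_
      · filter_upwards [hU₀.mem_nhds hM₀] with M hM using hmeas M hM
      · filter_upwards [ball_mem_nhds M₀ hε] with M hM
        refine ae_of_all _ fun ω => ?_
        have h := hC ω M hM 0 le_rfl
        rwa [norm_iteratedFDerivWithin_zero] at h
      · exact ae_of_all _ fun ω =>
          ((hsm ω).continuousOn.continuousWithinAt hM₀).continuousAt (hU₀.mem_nhds hM₀)
    exact key.continuousWithinAt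
  | succ n ih =>
    intro E' _ _ _ F hmeas hsm hbd
    -- the sample derivatives
    have hdiff : ∀ ω, ∀ M ∈ U₀, HasFDerivAt (fun M => F M ω) (fderiv ℝ (fun M => F M ω) M) M :=
      fun ω M hM => (((hsm ω).differentiableOn (by simp)).differentiableAt (hU₀.mem_nhds hM)).hasFDerivAt
    have hcont : ∀ ω, ContinuousOn (fun M => fderiv ℝ (fun M => F M ω) M) U₀ := fun ω =>
      (hsm ω).continuousOn_fderiv_of_isOpen hU₀ (by simp)
    have hint : ∀ M ∈ U₀, Integrable (F M) μ := by
      intro M hM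
      obtain ⟨ε, hε, C, -, hC⟩ := hbd M hM
      refine Integrable.of_bound (hmeas M hM) C (ae_of_all _ fun ω => ?_)
      have h := hC ω M (mem_ball_self hε) 0 (Nat.zero_le _)
      rwa [norm_iteratedFDerivWithin_zero] at h
    have hbd1 : ∀ M₀ ∈ U₀, ∃ ε > 0, ∃ C : ℝ, ball M₀ ε ⊆ U₀ ∧
        ∀ ω, ∀ M ∈ ball M₀ ε, ‖fderiv ℝ (fun M => F M ω) M‖ ≤ C := by
      intro M₀ hM₀
      obtain ⟨ε, hε, C, hball, hC⟩ := hbd M₀ hM₀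
      refine ⟨ε, hε, C, hball, fun ω M hM => ?_⟩
      rw [norm_fderiv_eq_norm_iteratedFDerivWithin_one hU₀ (hball hM)]
      exact hC ω M hM 1 (by simp)
    obtain ⟨hC1, hfd⟩ := contDiffOn_one_integral (μ := μ) hU₀ (F := F)
      (F' := fun M ω => fderiv ℝ (fun M => F M ω) M) hmeas hint hdiff hcont hbd1
    -- the derivative family satisfies the hypotheses at order `n`
    have hmeas' : ∀ M ∈ U₀, AEStronglyMeasurable (fun ω => fderiv ℝ (fun M => F M ω) M) μ := fun M hM =>
      aestronglyMeasurable_fderiv_param' (hU₀.mem_nhds hM) hmeas fun ω => hdiff ω M hM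
    have hsm' : ∀ ω, ContDiffOn ℝ n (fun M => fderiv ℝ (fun M => F M ω) M) U₀ := fun ω =>
      (hsm ω).fderiv_of_isOpen hU₀ (by simp)
    have hbd' : ∀ M₀ ∈ U₀, ∃ ε > 0, ∃ C : ℝ, ball M₀ ε ⊆ U₀ ∧ ∀ ω, ∀ M ∈ ball M₀ ε, ∀ k ≤ n,
        ‖iteratedFDerivWithin ℝ k (fun M => fderiv ℝ (fun M => F M ω) M) U₀ M‖ ≤ C := by
      intro M₀ hM₀
      obtain ⟨ε, hε, C, hball, hC⟩ := hbd M₀ hM₀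
      refine ⟨ε, hε, C, hball, fun ω M hM k hk => ?_⟩
      have h := hC ω M hM (k + 1) (by omega)
      rwa [← norm_iteratedFDerivWithin_fderiv_of_isOpen hU₀ (hball hM) k] at h
    have hCn := ih hmeas' hsm' hbd'
    -- assemble
    rw [Nat.cast_succ]
    refine (contDiffOn_succ_iff_fderiv_of_isOpen (𝕜 := ℝ) (n := n) (f := fun M => ∫ ω, F M ω ∂μ) hU₀).2
      ⟨hC1.differentiableOn one_ne_zero, fun h => absurd h (by simp), ?_⟩
    exact hCn.congr fun M hM => hfd M hM

end Summit.QuantumFields.YangMills.Theorems.ColdStartUniversality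

end
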